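import Summits.BirchSwinnertonDyer.BirchSwinnertonDyer.Theorems.KimAtThreeDeepUpperExpStarFactsCanonical
import HarnessLib

/-!
# The unit step, stratum-free: a rescaling `e • d` of a local Néron line that keeps `hdual` has `‖e‖ = 1`
# (route `KimAtThreeKolyvagin`, rung W2, cruxes 19076 / 19560; cell `bsd-addord`, seat w2-c3 gen 8)

HONEST FRAMING. Theorems only (local instances on `ℚ_v` exactly as in `KimAtThreeDeepUpperExpStarFacts`); no
named fact is used; nothing is closed or booked; BSD is not proved by any of this.

WHY. The cite fact (S5b-tower) (`PAdicHodge.exists_smul_range_expStarCoord_tower_iff_trace_log`, instantiated in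
`KimAtThreeDeepUpperExpStarTowerRange.exists_smul_ranges_of_facts`) normalises `exp*_ω` at `ℚ_v` and at a factor
field `L` by ONE rescaling `e • d`, `e • dw` of the line data, with `hdual` for `e • d`. The consumers' packages
(w2-c2 g9's hLatᵘ for item 20013 / cruxes 19075–19076, acc4's hLog₀ for crux 19560) are stated for a line `d` that
ALREADY has `hdual`. This file proves that then `e` is a UNIT — so `range(exp*_{dw}) = e · range(exp*_{e•dw})` has
the same integrality as the trace-dual lattice — WITHOUT any Kato-stratum hypothesis (acc4's planned unit step used
`dual_{ℚ₃} = ℤ₃`, valid only on the stratum `Addv ∧ 3 ∤ c₃ ∧ E(ℚ₃)[3] = 0`):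

* §1 (`X/ℚ_p` any `p`-integral elliptic curve, `log_ω = LocalLog.padicLog X`): the log-dual set
  `D = {a : ∀ Q, ‖a · log_ω Q‖ ≤ 1}` is balanced (`dual_of_norm_le`), contains `N = [E(ℚ_p) : E⁽²⁾(ℚ_p)] ≠ 0`
  (`index_mem_dual`: `log_ω` is BOUNDED, `N · log_ω Q = L(N • Q)`, `‖L‖ = ‖z‖ ≤ p⁻²` on `E⁽²⁾`) and misses `p⁻³`
  (`not_dual`: `p²` is a logarithm, `exists_mem_padicLimitLog_eq`); hence a multiplier `u · D ⊆ D` has `‖u‖ ≤ 1`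
  (`norm_le_one_of_mul_dual`).
* §2 (`W/ℚ` globally minimal, place `v ∋ p`, local Néron line `d`, any `ι : ℚ_v →+* ℚ_p`):
  `norm_map_eq_one_of_hdual_smul` — **`hdual(d) ∧ hdual(e • d) ⇒ ‖ι e‖ = 1`** (`exp*_{e•ω} = e⁻¹ exp*_ω`, so
  `(ι e)^{±1} · D ⊆ D`); `mem_integers_of_hdual_smul` — `e, e⁻¹ ∈ 𝒪_v` (rigidity `ringHom_place_padic_ext`:
  `ι = padicEquiv`, which identifies the unit balls).

References: [Kato1993LNM1553] Ch. II §1.2.4, Ex. 1.3.5 (scale law of `exp*_ω`); [SilvermanAEC2009] IV.6.4(b),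
VII.6.3 (`log : E⁽²⁾(ℚ_p) ≅ p²ℤ_p`, finite index); [SerreLocalFields1979] Ch. II §5.
-/

set_option autoImplicit false
-- the Theorems namespace of a single-conjunct summit repeats the summit name by design (D-0017)
set_option linter.dupNamespace false

noncomputable section

open scoped NumberField NNReal Classical
open Field ValuativeRel IsDedekindDomain NumberField
open Literature.NumberTheory.GaloisRepresentations
open Literature.NumberTheory.GaloisRepresentations.PeriodRingData
open Literature.NumberTheory.PAdicHodge
open Literature.NumberTheory.EllipticCurves WeierstrassCurve
open Summit.BirchSwinnertonDyer.BirchSwinnertonDyer.Theorems.KimAtThreeDeepLowerExpStarOmega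
open Summit.BirchSwinnertonDyer.BirchSwinnertonDyer.Theorems.KimAtThreeDeepLowerExpStarOmegaPlace
open Summit.BirchSwinnertonDyer.BirchSwinnertonDyer.Theorems.KimAtThreeDeepUpperExpStarTransport
open Summit.BirchSwinnertonDyer.BirchSwinnertonDyer.Theorems.KimAtThreeDeepUpperExpStarFactsCanonical
open Summit.BirchSwinnertonDyer.Rank1Residual.GaloisImage
open Summit.BirchSwinnertonDyer.Rank1Residual.Additive (LocalLog.padicLog)
open Summit.BirchSwinnertonDyer.Rank1Residual.Additive.LocalLog (padicLog_apply padicLog_apply_of_mem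
  index_formalFiltration_two_ne_zero)
open Rat.HeightOneSpectrum

namespace Summit.BirchSwinnertonDyer.BirchSwinnertonDyer.Theorems.KimAtThreeDeepUpperExpStarUnit

/-! ### §1 The log-dual set `D = {a : ∀ Q ∈ E(ℚ_p), ‖a · log_ω Q‖ ≤ 1}` is a proper non-zero balanced set -/

section Dual

variable {p : ℕ} [Fact p.Prime] (X : WeierstrassCurve ℚ_[p]) [X.IsIntegral ℤ_[p]] [X.IsElliptic]

/-- `D` is balanced: if `a ∈ D` and `‖b‖ ≤ ‖a‖` then `b ∈ D`. [folklore] -/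
theorem dual_of_norm_le {a b : ℚ_[p]} (ha : ∀ Q : X.toAffine.Point, ‖a * LocalLog.padicLog X Q‖ ≤ 1)
    (hb : ‖b‖ ≤ ‖a‖) : ∀ Q : X.toAffine.Point, ‖b * LocalLog.padicLog X Q‖ ≤ 1 := by
  intro Q
  refine le_trans ?_ (ha Q)
  rw [norm_mul, norm_mul]
  exact mul_le_mul_of_nonneg_right hb (norm_nonneg _)

/-- **`D ∋ N`**, `N = [E(ℚ_p) : E⁽²⁾(ℚ_p)]` (so `D ≠ 0`): `N · log_ω Q = L(N • Q)` has norm `‖z(N • Q)‖ ≤ p⁻² ≤ 1`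
— the logarithm is BOUNDED on `E(ℚ_p)`. [cite: SilvermanAEC2009, IV.6.4(b) and VII.6.3] -/
theorem index_mem_dual : ∀ Q : X.toAffine.Point,
    ‖((X.formalFiltration 2).index : ℚ_[p]) * LocalLog.padicLog X Q‖ ≤ 1 := by
  intro Q
  have hN : ((X.formalFiltration 2).index : ℚ_[p]) ≠ 0 :=
    Nat.cast_ne_zero.mpr (index_formalFiltration_two_ne_zero X)
  have h2 := (X.formalFiltration 2).nsmul_index_mem Q
  rw [padicLog_apply, mul_div_cancel₀ _ hN, X.norm_padicLimitLog_of_mem le_rfl h2]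
  refine h2.2.trans ?_
  have hp1 : (1 : ℝ) ≤ p := by exact_mod_cast (Fact.out : p.Prime).one_lt.le
  exact pow_le_one₀ (inv_nonneg.mpr (zero_le_one.trans hp1)) (inv_le_one_of_one_le₀ hp1)

/-- **`D ≠ ℚ_p`**: `p⁻³ ∉ D`, since `p²` is a logarithm (`log_ω : E⁽²⁾(ℚ_p) ≅ p²ℤ_p`) and `‖p⁻³ · p²‖ = p > 1`.
[cite: SilvermanAEC2009, IV.6.4(b) and VII.6.3] -/
theorem not_dual : ¬ ∀ Q : X.toAffine.Point, ‖((p : ℚ_[p]) ^ 3)⁻¹ * LocalLog.padicLog X Q‖ ≤ 1 := by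
  intro h
  have hp0 : (p : ℚ_[p]) ≠ 0 := Nat.cast_ne_zero.mpr (Fact.out : p.Prime).ne_zero
  have hy : ‖(p : ℚ_[p]) ^ 2‖ ≤ ((p : ℝ)⁻¹) ^ 2 := by rw [norm_pow, Padic.norm_p]
  obtain ⟨Q, hQ, hLQ⟩ := X.exists_mem_padicLimitLog_eq le_rfl hy
  have hlog : LocalLog.padicLog X Q = (p : ℚ_[p]) ^ 2 := by rw [padicLog_apply_of_mem X hQ, hLQ]
  have h1 := h Q
  rw [hlog, show ((p : ℚ_[p]) ^ 3)⁻¹ * (p : ℚ_[p]) ^ 2 = (p : ℚ_[p])⁻¹ by field_simp, norm_inv,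
    Padic.norm_p, inv_inv] at h1
  have hp1 : (1 : ℝ) < p := by exact_mod_cast (Fact.out : p.Prime).one_lt
  exact absurd h1 (not_le.mpr hp1)

/-- **A multiplier of `D` has norm `≤ 1`**: if `u · D ⊆ D` then `‖u‖ ≤ 1` (`D ∋ N ≠ 0` is balanced and
proper: for `‖u‖ > 1` the elements `uⁿ N ∈ D` are unbounded, so `D = ℚ_p`). [folklore] -/
theorem norm_le_one_of_mul_dual {u : ℚ_[p]}
    (hu : ∀ a : ℚ_[p], (∀ Q : X.toAffine.Point, ‖a * LocalLog.padicLog X Q‖ ≤ 1) →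
      ∀ Q : X.toAffine.Point, ‖u * a * LocalLog.padicLog X Q‖ ≤ 1) :
    ‖u‖ ≤ 1 := by
  by_contra hgt
  rw [not_le] at hgt
  set N : ℚ_[p] := ((X.formalFiltration 2).index : ℚ_[p]) with hNdef
  have hN0 : N ≠ 0 := Nat.cast_ne_zero.mpr (index_formalFiltration_two_ne_zero X)
  -- `uⁿ N ∈ D` for every `n`
  have hpow : ∀ n : ℕ, ∀ Q : X.toAffine.Point, ‖u ^ n * N * LocalLog.padicLog X Q‖ ≤ 1 := by
    intro n
    induction n with
    | zero => intro Q; rw [pow_zero, one_mul]; exact index_mem_dual X Q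
    | succ n ih =>
      intro Q
      have h := hu (u ^ n * N) ih Q
      rwa [← mul_assoc, ← pow_succ'] at h
  -- choose `n` with `‖p⁻³‖ ≤ ‖uⁿ N‖`
  obtain ⟨n, hn⟩ := pow_unbounded_of_one_lt (‖((p : ℚ_[p]) ^ 3)⁻¹‖ / ‖N‖) hgt
  have hle : ‖((p : ℚ_[p]) ^ 3)⁻¹‖ ≤ ‖u ^ n * N‖ := by
    rw [norm_mul, norm_pow]
    exact (div_le_iff₀ (norm_pos_iff.mpr hN0)).mp hn.le
  exact not_dual X (dual_of_norm_le X (hpow n) hle)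

end Dual

/-! ### §2 At the place: a rescaling keeping `hdual` is a unit -/

section Place

variable (W : WeierstrassCurve ℚ) [W.IsElliptic] (p : ℕ) [Fact p.Prime]
  (v : HeightOneSpectrum (𝓞 ℚ)) [hv : Fact (((p : ℕ) : 𝓞 ℚ) ∈ v.asIdeal)]

-- the tree's `ℚ`-algebra structure on `ℚ_v` first (see `KimAtThreeDeepUpperExpStarFacts`)
attribute [local instance 100000] NumberField.Place.instAlgebraCompletion
attribute [local instance] valuativeRelPlace topologicalSpacePlace
attribute [local instance] isNonarchimedeanLocalField_place charZero_place
attribute [local instance] padicAlgebraPlace fact_not_isUnit_place isAdicComplete_place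

/-- **The unit step (stratum-free).** If `hdual` holds for the line `d` AND for its rescaling `e • d` (read in
`ℚ_p` through the same `ι`), then `‖ι e‖ = 1`: `exp*_{e•ω} = e⁻¹ exp*_ω`, so `ι(e)^{±1}` multiplies the log-dual set
`D`, and a multiplier of `D` has norm `≤ 1` (`norm_le_one_of_mul_dual`: `log_ω` is bounded and non-zero on `E(ℚ_p)`).
No Kato-stratum hypothesis (no `Addv`, `3 ∤ c₃`, `E(ℚ₃)[3] = 0`). [cite: Kato1993LNM1553, Ch. II §1.2.4 and Ex. 1.3.5] [cite: SilvermanAEC2009, IV.6.4(b) and VII.6.3] -/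
theorem norm_map_eq_one_of_hdual_smul [W.IsGloballyMinimal] (d : LocalNeronLineAt W p v)
    (hinj : (bdRPeriodRingData (valuation_place_lt_one p v)).CupLogInjective (logCyclotomic p)
      (localRationalTateRep W p (galRestrictPlace v)))
    (hex : ∀ z : contOneCocycles (localRationalTateRep W p (galRestrictPlace v)).toTopRep,
      (bdRPeriodRingData (valuation_place_lt_one p v)).HasDualExp (logCyclotomic p)
        (localRationalTateRep W p (galRestrictPlace v)) fun σ => z.1 σ)
    (ι : Place.Completion (Sum.inr v : Place ℚ) →+* ℚ_[p])
    (hd : ∀ a : ℚ_[p], (∃ y, expStarOmegaPadicAt d hinj hex ι y = a) ↔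
      ∀ Q : (W.baseChange ℚ_[p]).toAffine.Point, ‖a * LocalLog.padicLog (W.baseChange ℚ_[p]) Q‖ ≤ 1)
    {e : Place.Completion (Sum.inr v : Place ℚ)} (he : e ≠ 0)
    (hde : ∀ a : ℚ_[p], (∃ y, expStarOmegaPadicAt (d.smul e he) hinj hex ι y = a) ↔
      ∀ Q : (W.baseChange ℚ_[p]).toAffine.Point, ‖a * LocalLog.padicLog (W.baseChange ℚ_[p]) Q‖ ≤ 1) :
    ‖ι e‖ = 1 := by
  have hιe : ι e ≠ 0 := (map_ne_zero ι).mpr he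
  -- `exp*_{e•d} y = (ι e)⁻¹ · exp*_d y`
  have hsmul : ∀ y, expStarOmegaPadicAt (d.smul e he) hinj hex ι y = (ι e)⁻¹ * expStarOmegaPadicAt d hinj hex ι y := by
    intro y
    rw [expStarOmegaPadicAt_apply, expStarOmegaPadicAt_apply, ← map_inv₀, ← map_mul]
    exact congrArg ι (expStarOmega_smul _ _ d he y)
  -- `ι e` and `(ι e)⁻¹` multiply `D`
  have h1 : ∀ a : ℚ_[p], (∀ Q : (W.baseChange ℚ_[p]).toAffine.Point, ‖a * LocalLog.padicLog (W.baseChange ℚ_[p]) Q‖ ≤ 1) →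
      ∀ Q : (W.baseChange ℚ_[p]).toAffine.Point, ‖ι e * a * LocalLog.padicLog (W.baseChange ℚ_[p]) Q‖ ≤ 1 := by
    intro a ha
    obtain ⟨y, hy⟩ := (hde a).mpr ha
    rw [hsmul] at hy
    have hy' : expStarOmegaPadicAt d hinj hex ι y = ι e * a := by
      rw [← hy, ← mul_assoc, mul_inv_cancel₀ hιe, one_mul]
    exact (hd (ι e * a)).mp ⟨y, hy'⟩
  have h2 : ∀ a : ℚ_[p], (∀ Q : (W.baseChange ℚ_[p]).toAffine.Point, ‖a * LocalLog.padicLog (W.baseChange ℚ_[p]) Q‖ ≤ 1) →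
      ∀ Q : (W.baseChange ℚ_[p]).toAffine.Point, ‖(ι e)⁻¹ * a * LocalLog.padicLog (W.baseChange ℚ_[p]) Q‖ ≤ 1 := by
    intro a ha
    obtain ⟨y, hy⟩ := (hd a).mpr ha
    have hy' : expStarOmegaPadicAt (d.smul e he) hinj hex ι y = (ι e)⁻¹ * a := by rw [hsmul, hy]
    exact (hde ((ι e)⁻¹ * a)).mp ⟨y, hy'⟩
  have hle : ‖ι e‖ ≤ 1 := norm_le_one_of_mul_dual (W.baseChange ℚ_[p]) h1
  have hge : ‖(ι e)⁻¹‖ ≤ 1 := norm_le_one_of_mul_dual (W.baseChange ℚ_[p]) h2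
  rw [norm_inv] at hge
  have hpos : 0 < ‖ι e‖ := norm_pos_iff.mpr hιe
  have hge' : 1 ≤ ‖ι e‖ := by
    by_contra hlt
    rw [not_le] at hlt
    exact absurd hge (not_le.mpr ((one_lt_inv₀ hpos).mpr hlt))
  exact le_antisymm hle hge'

/-- **The rescaling is a `v`-adic unit**: under the hypotheses of `norm_map_eq_one_of_hdual_smul`, `e ∈ 𝒪_v` and
`e⁻¹ ∈ 𝒪_v` (every `ι : ℚ_v →+* ℚ_p` is Mathlib's `padicEquiv`, which identifies the unit balls).
[cite: SerreLocalFields1979, Ch. II §5] -/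
theorem mem_integers_of_hdual_smul [W.IsGloballyMinimal] (d : LocalNeronLineAt W p v)
    (hinj : (bdRPeriodRingData (valuation_place_lt_one p v)).CupLogInjective (logCyclotomic p)
      (localRationalTateRep W p (galRestrictPlace v)))
    (hex : ∀ z : contOneCocycles (localRationalTateRep W p (galRestrictPlace v)).toTopRep,
      (bdRPeriodRingData (valuation_place_lt_one p v)).HasDualExp (logCyclotomic p)
        (localRationalTateRep W p (galRestrictPlace v)) fun σ => z.1 σ)
    (ι : Place.Completion (Sum.inr v : Place ℚ) →+* ℚ_[p])
    (hd : ∀ a : ℚ_[p], (∃ y, expStarOmegaPadicAt d hinj hex ι y = a) ↔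
      ∀ Q : (W.baseChange ℚ_[p]).toAffine.Point, ‖a * LocalLog.padicLog (W.baseChange ℚ_[p]) Q‖ ≤ 1)
    {e : Place.Completion (Sum.inr v : Place ℚ)} (he : e ≠ 0)
    (hde : ∀ a : ℚ_[p], (∃ y, expStarOmegaPadicAt (d.smul e he) hinj hex ι y = a) ↔
      ∀ Q : (W.baseChange ℚ_[p]).toAffine.Point, ‖a * LocalLog.padicLog (W.baseChange ℚ_[p]) Q‖ ≤ 1) :
    e ∈ v.adicCompletionIntegers ℚ ∧ e⁻¹ ∈ v.adicCompletionIntegers ℚ := by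
  have hpv : ((p : ℕ) : 𝓞 ℚ) ∈ v.asIdeal := hv.out
  have h1 := norm_map_eq_one_of_hdual_smul W p v d hinj hex ι hd he hde
  have hp' := primesEquiv_eq p v hpv
  subst hp'
  let eA : Place.Completion (Sum.inr v : Place ℚ) →+* ℚ_[((primesEquiv v : Nat.Primes) : ℕ)] :=
    (adicCompletion.padicEquiv (R := 𝓞 ℚ) v : v.adicCompletion ℚ →+* _)
  rw [ringHom_place_padic_ext _ v ι eA] at h1
  refine ⟨(norm_padicEquiv_le_one_iff v e).mp h1.le, (norm_padicEquiv_le_one_iff v e⁻¹).mp ?_⟩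
  change ‖eA e⁻¹‖ ≤ 1
  rw [map_inv₀, norm_inv, h1, inv_one]

end Place

end Summit.BirchSwinnertonDyer.BirchSwinnertonDyer.Theorems.KimAtThreeDeepUpperExpStarUnit

end
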